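import Summits.HodgeConjecture.HodgeConjecture.Theorems.Ring2HypothesesDescentMotivatedStarOperatorEdges
import Summits.HodgeConjecture.HodgeConjecture.Theorems.Ring2HypothesesDescentMotivatedVariational
import Summits.HodgeConjecture.HodgeConjecture.Theorems.Ring2DeformCMPivotAnchors
import HarnessLib

/-!
# Ring 2 hypotheses, descent face — the variational rows of `…MotivatedVariational` MODULO DELIGNE'S THÉORÈME DE LA
# PARTIE FIXE (c17) in place of André's Théorème 0.5 (c24): stage 3 of the ladder by name —
# `HC_CM ∧ (b07 | c8) ∧ c17 ⟹ (HC_AV ⟺ MotivatedImpliesAlgebraicAV)`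

research route conditional on HC_CM; not a corollary; Q11.4-sentence-2 already refuted in dim ≥ 3.
Cell `pub-hodge-ring2` (Hodge ladder STAGE 3), seat `ring2-b05` (binder row b05
`Ring2.Hypotheses.MotivatedImpliesAlgebraicAV`), gen 36. `HC_CM` — BY NAME `Theses.RankFourFaces.CMAbelianHodge`, never
restated — is an explicit HYPOTHESIS (a binder) in §2; nothing here proves a case of the Hodge conjecture; the rows
b05 / b07 and `HC_AV` stay OPEN; the numbers «10 · 0» do not move.

After gen 36 the tree derives André's deformation theorem `Andre1996_deformation` (c24) from Deligne's global invariant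
cycle theorem `deligne_globalInvariantCycles` (c17, *Hodge II* 4.1.1) ALONE (`Andre1996_deformation_of_globalInvariantCycles`:
leaves (A0) Mumford, (A1) Hironaka, (A3) = Thm. 0.4 in §5.1 form, (A5) = Prop. 2.1 (ii) are theorems). This file
re-keys the rows (V2), (V6d), (V7), (V8), (V9) of gen 30's `Ring2HypothesesDescentMotivatedVariational` accordingly —
every `(hD : Andre1996_deformation)` becomes `(hGIC : deligne_globalInvariantCycles)`:

* §1 (V2') `compactAbelianPencilVHC_of_motivatedImpliesAlgebraicAV_of_globalInvariantCycles`: b05 ⟹ compact-pencil VHC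
  mod {c17}; (V6d') `hc_av_iff_motivatedImpliesAlgebraicAV_of_globalInvariantCycles_of_andre1996`: `HC_AV ↔ b05`
  mod {c11, c12, c17} (André Lemmes 6.3.1–6.3.3 + partie fixe; Thm. 0.6.2-free); (V9')
  `HC_CM ∧ b05 ⟹ HC_AV` mod {c11, c17}.
* §2 (V7') **`HC_CM ∧ CMAnchoredFamilies ⟹` Théorème 0.6.2 (c2) mod {c17}**; (V7'') the same with row b07 replaced by
  its refereed source c8 `deligne1982_cmDenseMumfordTateFamilies` (`Ring2.Deform.cmAnchoredFamilies_of_deligne1982`):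
  **c2 ⟸ `HC_CM` ∧ c8 ∧ c17**; (V8') `HC_CM ∧ b07 ∧ b05 ⟹ HC_AV` mod {c17} and the EXACTNESS
  **`HC_CM ∧ c8 ∧ c17 ⟹ (HC_AV ↔ MotivatedImpliesAlgebraicAV)`** — stage 3's dictionary cell «b05 ≡ HC_AV» with modulus
  {HC_CM, Deligne 1982 (c8), Deligne 1971 (c17)} and NO theorem of André 1996 left as a named fact.

No definition, no named fact, no sorry. References: Andre1996Motifs (Thm. 0.5 p. 8, Thm. 0.6.2 p. 9, §5.1 p. 25, §6.3
pp. 31–33), DeligneHodgeII1971 (Thm. 4.1.1), Deligne1982HodgeCycles (Introduction p. 6, Prop. 6.1),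
CharlesSchnell2014Notes (Thm. 11.3.4, Conj. 11.3.1).
-/

noncomputable section

-- every declaration of this problem lives in `Summit.HodgeConjecture.HodgeConjecture.…` (summit = sub-problem)
set_option linter.dupNamespace false

open CategoryTheory AlgebraicGeometry
open Literature.AlgebraicGeometry Literature.AlgebraicGeometry.Motives
  Literature.AlgebraicGeometry.HodgeTheory Literature.AlgebraicGeometry.Deligne1982
open Literature.AlgebraicGeometry.Andre1996 (andre1996_cmAnchoredPencil
  andre1996_cmHodgeClasses_algebraicallyAnchoredPencils)

namespace Summit.HodgeConjecture.HodgeConjecture.Theorems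

open Ring2.Hypotheses

/-! ## §1 The 0.6.2-free rows modulo the partie fixe -/

/-- **(V2') `MotivatedImpliesAlgebraicAV ⟹ CompactAbelianPencilVHC` modulo {c17}** (gen 30's (V2) with Théorème 0.5
derived from the partie fixe). [cite: Andre1996Motifs, Thm. 0.5 (p. 8) and §5.1 (p. 25)] [cite: DeligneHodgeII1971, Théorème 4.1.1] -/
theorem compactAbelianPencilVHC_of_motivatedImpliesAlgebraicAV_of_globalInvariantCycles
    (hGIC : deligne_globalInvariantCycles) (h : MotivatedImpliesAlgebraicAV) : Ring2.Deform.CompactAbelianPencilVHC :=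
  compactAbelianPencilVHC_of_motivatedImpliesAlgebraicAV_of_deformation
    (Andre1996_deformation_of_globalInvariantCycles hGIC) h

/-- **(V6d') `HC_AV ↔ MotivatedImpliesAlgebraicAV` modulo {c11, c12, c17}** (André Lemmes 6.3.1–6.3.3 and Deligne's
partie fixe; Théorème 0.6.2 and Théorème 0.5 are not named facts of this statement).
[cite: Andre1996Motifs, §6.3 Lemmes 6.3.1–6.3.3 (pp. 31–33)] [cite: DeligneHodgeII1971, Théorème 4.1.1] -/
theorem hc_av_iff_motivatedImpliesAlgebraicAV_of_globalInvariantCycles_of_andre1996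
    (hGIC : deligne_globalInvariantCycles) (h₂₁ : andre1996_cmAnchoredPencil)
    (h₂₂ : andre1996_cmHodgeClasses_algebraicallyAnchoredPencils) :
    Theses.PadicSemiregularLift.HodgeAbelianVarieties ↔ MotivatedImpliesAlgebraicAV :=
  hc_av_iff_motivatedImpliesAlgebraicAV_of_deformation_of_andre1996
    (Andre1996_deformation_of_globalInvariantCycles hGIC) h₂₁ h₂₂

/-- **(V9') `HC_CM ∧ MotivatedImpliesAlgebraicAV ⟹ HC_AV` modulo {c11, c17}** (`HC_CM` load-bearing, by name).
[cite: Andre1996Motifs, §6.3 Lemme 6.3.1 (p. 31)] [cite: DeligneHodgeII1971, Théorème 4.1.1] -/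
theorem hc_av_of_hc_cm_of_motivatedImpliesAlgebraicAV_of_globalInvariantCycles_of_andre1996
    (hCM : Theses.RankFourFaces.CMAbelianHodge) (hGIC : deligne_globalInvariantCycles)
    (h₂₁ : andre1996_cmAnchoredPencil) (h : MotivatedImpliesAlgebraicAV) :
    Theses.PadicSemiregularLift.HodgeAbelianVarieties :=
  hc_av_of_hc_cm_of_motivatedImpliesAlgebraicAV_of_deformation_of_andre1996 hCM
    (Andre1996_deformation_of_globalInvariantCycles hGIC) h₂₁ h

/-! ## §2 `HC_CM` load-bearing: Théorème 0.6.2 and the exactness `HC_AV ↔ b05` modulo Deligne 1971 + Deligne 1982 -/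

/-- **(V7') `HC_CM ∧ CMAnchoredFamilies ⟹` Théorème 0.6.2 (c2) modulo {c17}**: every Hodge class on every complex
abelian variety is motivated, from the binder `HC_CM` (by name), row b07 and Deligne's partie fixe.
[cite: Andre1996Motifs, Thm. 0.6.2 (p. 9) and §6.3 a) (pp. 31–33)] [cite: Deligne1982HodgeCycles, Introduction p. 6 and Prop. 6.1]
[cite: DeligneHodgeII1971, Théorème 4.1.1] -/
theorem hodgeClasses_abelianVariety_motivated_of_hc_cm_of_cmAnchoredFamilies_of_globalInvariantCycles
    (hCM : Theses.RankFourFaces.CMAbelianHodge) (hMT : CMAnchoredFamilies) (hGIC : deligne_globalInvariantCycles) :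
    Andre1996_hodgeClasses_abelianVariety_motivated :=
  hodgeClasses_abelianVariety_motivated_of_hc_cm_of_cmAnchoredFamilies_of_deformation hCM hMT
    (Andre1996_deformation_of_globalInvariantCycles hGIC)

/-- **(V7'') c2 ⟸ `HC_CM` ∧ c8 ∧ c17**: Théorème 0.6.2 from the binder `HC_CM`, Deligne 1982's CM-dense Mumford–Tate
families (`deligne1982_cmDenseMumfordTateFamilies`, the refereed source of row b07 via
`Ring2.Deform.cmAnchoredFamilies_of_deligne1982`) and Deligne 1971's partie fixe — no theorem of André 1996 is a named
fact of this statement. [cite: Andre1996Motifs, Thm. 0.6.2 (p. 9)] [cite: Deligne1982HodgeCycles, Prop. 6.1]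
[cite: DeligneHodgeII1971, Théorème 4.1.1] -/
theorem hodgeClasses_abelianVariety_motivated_of_hc_cm_of_deligne1982_of_globalInvariantCycles
    (hCM : Theses.RankFourFaces.CMAbelianHodge) (h8 : deligne1982_cmDenseMumfordTateFamilies)
    (hGIC : deligne_globalInvariantCycles) : Andre1996_hodgeClasses_abelianVariety_motivated :=
  hodgeClasses_abelianVariety_motivated_of_hc_cm_of_cmAnchoredFamilies_of_globalInvariantCycles hCM
    (Ring2.Deform.cmAnchoredFamilies_of_deligne1982 h8) hGIC

/-- **(V8') `HC_CM ∧ CMAnchoredFamilies ∧ MotivatedImpliesAlgebraicAV ⟹ HC_AV` modulo {c17}.**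
[cite: Andre1996Motifs, Thm. 0.5 and Thm. 0.6.2 (pp. 8–9)] [cite: DeligneHodgeII1971, Théorème 4.1.1] -/
theorem hc_av_of_hc_cm_of_cmAnchoredFamilies_of_motivatedImpliesAlgebraicAV_of_globalInvariantCycles
    (hCM : Theses.RankFourFaces.CMAbelianHodge) (hMT : CMAnchoredFamilies) (hGIC : deligne_globalInvariantCycles)
    (h : MotivatedImpliesAlgebraicAV) : Theses.PadicSemiregularLift.HodgeAbelianVarieties :=
  hc_av_of_hc_cm_of_cmAnchoredFamilies_of_motivatedImpliesAlgebraicAV_of_deformation hCM hMT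
    (Andre1996_deformation_of_globalInvariantCycles hGIC) h

/-- **STAGE 3 EXACTNESS: `HC_CM ∧ c8 ∧ c17 ⟹ (HC_AV ↔ MotivatedImpliesAlgebraicAV)`** — assuming the stage-2 target
`HC_CM` (by name), Deligne 1982's CM-dense Mumford–Tate families and Deligne 1971's partie fixe, the Hodge conjecture
for abelian varieties is EQUIVALENT to row b05 «motivated classes on abelian varieties are algebraic»: «→» is the
tree's `motivatedImpliesAlgebraicAV_of_hc_av_holds` (unconditional), «←» is (V7'') + the dictionary's
`hc_av_of_andre_of_motivatedImpliesAlgebraicAV`. [cite: Andre1996Motifs, Thm. 0.6.2 (p. 9) and §2.1 (p. 14)]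
[cite: Deligne1982HodgeCycles, Prop. 6.1] [cite: DeligneHodgeII1971, Théorème 4.1.1] -/
theorem hc_av_iff_motivatedImpliesAlgebraicAV_of_hc_cm_of_deligne1982_of_globalInvariantCycles
    (hCM : Theses.RankFourFaces.CMAbelianHodge) (h8 : deligne1982_cmDenseMumfordTateFamilies)
    (hGIC : deligne_globalInvariantCycles) :
    Theses.PadicSemiregularLift.HodgeAbelianVarieties ↔ MotivatedImpliesAlgebraicAV :=
  ⟨motivatedImpliesAlgebraicAV_of_hc_av_holds, fun h ↦
    hc_av_of_hc_cm_of_cmAnchoredFamilies_of_motivatedImpliesAlgebraicAV_of_globalInvariantCycles hCM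
      (Ring2.Deform.cmAnchoredFamilies_of_deligne1982 h8) hGIC h⟩

end Summit.HodgeConjecture.HodgeConjecture.Theorems

end
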